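import Literature.MathematicalPhysics.QuantumFieldTheory.Balaban1983to89.Node00.MultiScaleFibreChartLagrange
import Literature.MathematicalPhysics.QuantumFieldTheory.Balaban1983to89.Node00.MultiScaleFibreChartCurvatureUniform
import Literature.MathematicalPhysics.QuantumFieldTheory.Balaban1983to89.B14Eq216Concrete

/-!
# NODE 00 — THE CANONICAL MULTI-SCALE CHART IS LOCAL IN THE BASE CONFIGURATION: `Ψ_{𝐁,W,U}` reads `U` only on `inputs 𝐁`; guarded proxies; local editions of the chart letters

Cell `pub-ymgap`, width seat `pub-ymgap-dag-n12-w4` generation 3 (HUMAN RULING D-0149; lane N12 = [16] = [Balaban1989LargeFieldII] Prop. 1 ∕ (1.77) at the record; bus CLAIM-8 of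
2026-08-28).  NEW leaf over this seat's `MultiScaleFibreChartLagrange` (p610492) and `MultiScaleFibreChartCurvatureUniform` (p615328) and the tree's locality of iterated averaging
`B14.Eq216Concrete.iter_local` ∕ `inputs`; nothing modified.  `--kind proof --supports stmt-QuantumFields-26907` (K1⁸; count-neutral; theorems only, no definition).

WHY.  The chart letters of this lineage (the Lagrange multiplier `exists_lam_msChart_of_surjective`, the regularity binders `hΨ`, `hΨ₂`, the uniform curvature bound
`exists_uniform_chartCurvature_sq_bound`) carry the GLOBAL small-field guard `SmallBelow (avOfRecord F N K) k U₀` and GLOBAL near-flatness `‖coeField U₀ − 1‖ ≤ ρ″` of the base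
configuration — hypotheses over EVERY bond of the torus, which the record's base configuration does not meet away from the constraint region (sibling n12-w5's finding «LOCATED-hU»,
bus 2026-08-28 ≈08:05Z).  But the chart `Ψ_{𝐁,W,U}(X) = (π log(W_j(c)*·Ū^j(U·e^X)(c)))_{(j,c)}` reads the configuration `U·e^X` ONLY through the finitely many constrained averages
`Ū^j(·)(c)`, `c` a bond meeting `Γ_j`, and each of those reads the fine bonds `feeds j c` only ([4] (2.11): the tree's `iter_local`, proved from the locality axiom `Averaging.local_dep`).
Hence `Ψ_{𝐁,W,U} = Ψ_{𝐁,W,U′}` AS FUNCTIONS OF `X` for any `U′` agreeing with `U` on `inputs 𝐁 = ⋃ feeds j c` (§1), and so do the fibre condition and `IsFibreChartNear` (the chart's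
derivative, second derivative, level set, submersivity all transfer).  A configuration near-flat ON `inputs 𝐁` has a GLOBALLY near-flat PROXY `U′` (flatten it off `inputs 𝐁`, §2), which is
guarded; applying the global letters to the proxy and transporting back gives the LOCAL EDITIONS (§3): every guard ∕ near-flatness hypothesis is asked only on `inputs 𝐁` — for the
determining set of record `𝐁 = Bj M₁ Z k` these are the fine bonds under the blocks around `maxDomT M₁ Z`, the neighbourhood where the lane's (r1) plaquette-local `hU`
(`B16Ineq17NearFlatWilsonLettersLocal`) lives and where (r3) produces near-flatness.  The first variation `IsCritOnFibre … U` and the Wilson action stay at the TRUE configuration `U`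
(they are not local and are not swapped).

CONTENTS.  §1 `expChart_eqOn`, `avgFamily_eq_of_eqOn_inputs`, `avgFamily_expChart_eq_of_eqOn_inputs`, `agreeOn_iff_of_eqOn_inputs`, ★★ `msChart_congr_of_eqOn_inputs`,
★ `isFibreChartNear_iff_of_eqOn_inputs`; §2 `exists_nearFlat_eqOn` (the flattened proxy; the witness lives inside the proof — no definition); §3 proxy currency:
`hasStrictFDerivAt_msChart_of_proxy`, `differentiableAt_msChart_of_proxy`, `contDiffAt_msChart_of_proxy`, `hasFDerivAt_fderiv_msChart_of_proxy`,
`eventually_agreeOn_of_msChart_eq_of_proxy`, ★ `isFibreChartNear_msChart_of_surjective_of_proxy`, ★★ `exists_lam_msChart_of_surjective_of_proxy`,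
`eventually_differentiableAt_msChart_of_proxy`, `regularity_binders_msChart_of_proxy` (the J-C pair `hΨ₂`∕`hΨd`), ★ `exists_lam_msChart_bound_of_rightInverse_fun_of_proxy`,
★★ `exists_lam_mu_msChart_of_rightInverse_fun_of_proxy`, ★★ `exists_lam_mu_msChart_Bj_of_isMinimizer_regMSCoPOfRecord_of_proxy` (the J-C pair `hlam`∕`hμ` at the endpoint's objects); §4 near-flat-on-inputs currency: ★★ `exists_radius_proxy` (one radius per height:
near-flat on `inputs 𝐁` and in the fibre ⇒ a guarded, globally near-flat proxy in the fibre), ★★★ `exists_uniform_chartCurvature_sq_bound_local` (p615328's uniform curvature bound with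
`‖coeField U₀ − 1‖ ≤ ρ″` replaced by `∀ b ∈ inputs 𝐁, ‖↑(U₀ b) − 1‖ ≤ ρ″`).

HONEST FRAMING: lattice bookkeeping over the tree's locality axiom and kernel calculus; no definition; nothing of [15]∕[16]∕[4] asserted; the near-flatness ON `inputs 𝐁` at the
record is NOT produced here (it is the lane's (r3)); N12 NOT discharged; K1⁸ NOT closed; counts unmoved; one finite `T⁴` programme at fixed `ε` — NOT continuum ∕ ℝ⁴ ∕ OS ∕
mass gap ∕ Clay (R4 closes the conditional rung `BalabanLadder.UV` only).  No `sorry`, no `axiom`, no `instance`, no `notation`.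
-/

noncomputable section

namespace Literature.MathematicalPhysics.QuantumFieldTheory.Balaban1983to89.Node00

open Filter Topology
open T4Continuum (T4Family)
open B15DeterminingSets
open B14.Eq216Concrete (feeds inputs mem_inputs iter_local)
open T4AdjointCovarianceUnitary (lieSU expSU)
open B14.Eq213DetSet (Bj Bj_of_gt)
open scoped Matrix.Norms.L2Operator

variable {F : T4Family} {N : ℕ} [NeZero N]
variable {K k : ℕ} {𝔹 : DetSet (F.P K)} {W : MSField (F.P K) (SU N)} {U U' : GaugeField (F.P K) 0 (SU N)}

/-! ## §1  Locality of the chart in the base configuration -/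

omit [NeZero N] in
/-- `U = U′` on `S` ⇒ `U·e^X = U′·e^X` on `S`. [cite: Balaban1985RegularSpaces, (1.10) p.77 (bookkeeping)] -/
theorem expChart_eqOn {S : Set (PBond (F.P K) 0)} (h : ∀ b ∈ S, U b = U' b) (X : PBond (F.P K) 0 → lieSU (Fin N)) :
    ∀ b ∈ S, expChart U X b = expChart U' X b := fun b hb => by
  unfold expChart
  rw [h b hb]

/-- **A constrained average reads `U` on `inputs 𝐁` only** (standing range): `U = U′` on `inputs 𝐁` ⇒ `Ū^j(U)(c) = Ū^j(U′)(c)` for every bond `c` meeting `Γ_j`, `j ≤ k ≤ m + K`.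
[cite: Balaban1988Convergent, (2.11) p.256] -/
theorem avgFamily_eq_of_eqOn_inputs (hk : k ≤ (F.P K).m + (F.P K).K) (h : ∀ b ∈ inputs 𝔹, U b = U' b) {j : ℕ} (hj : j ≤ k)
    {c : PBond (F.P K) j} (hc : c ∈ bondsOf (𝔹 j)) :
    avgFamily (avOfRecord F N K) U j c = avgFamily (avOfRecord F N K) U' j c :=
  iter_local (avOfRecord F N K) j (hj.trans hk) U U' c fun b₀ hb₀ => h b₀ (mem_inputs.2 ⟨j, c, hc, hb₀⟩)

/-- The same along the chart: `Ū^j(U·e^X)(c) = Ū^j(U′·e^X)(c)` at every constrained bond, for every `X`. [cite: Balaban1988Convergent, (2.11) p.256] -/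
theorem avgFamily_expChart_eq_of_eqOn_inputs (hk : k ≤ (F.P K).m + (F.P K).K) (h : ∀ b ∈ inputs 𝔹, U b = U' b)
    (X : PBond (F.P K) 0 → lieSU (Fin N)) {j : ℕ} (hj : j ≤ k) {c : PBond (F.P K) j} (hc : c ∈ bondsOf (𝔹 j)) :
    avgFamily (avOfRecord F N K) (expChart U X) j c = avgFamily (avOfRecord F N K) (expChart U' X) j c :=
  avgFamily_eq_of_eqOn_inputs hk (expChart_eqOn h X) hj hc

/-- **The fibre condition is local**: for `𝐁` with no member above `k ≤ m + K`, configurations agreeing on `inputs 𝐁` lie in the fibre `{Ū_𝐁 = W}` together.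
[cite: Balaban1988Convergent, (2.10)–(2.11) p.256] -/
theorem agreeOn_iff_of_eqOn_inputs (h𝔹 : ∀ j, k < j → 𝔹 j = ∅) (hk : k ≤ (F.P K).m + (F.P K).K) {V V' : GaugeField (F.P K) 0 (SU N)}
    (hV : ∀ b ∈ inputs 𝔹, V b = V' b) :
    AgreeOn 𝔹 (avgFamily (avOfRecord F N K) V) W ↔ AgreeOn 𝔹 (avgFamily (avOfRecord F N K) V') W := by
  have key : ∀ {V V' : GaugeField (F.P K) 0 (SU N)}, (∀ b ∈ inputs 𝔹, V b = V' b) →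
      AgreeOn 𝔹 (avgFamily (avOfRecord F N K) V) W → AgreeOn 𝔹 (avgFamily (avOfRecord F N K) V') W := by
    intro V V' hV hA j c hc
    by_cases hj : j ≤ k
    · rw [← avgFamily_eq_of_eqOn_inputs hk hV hj hc]
      exact hA j c hc
    · exfalso
      rw [h𝔹 j (lt_of_not_ge hj)] at hc
      simp [bondsOf] at hc
  exact ⟨key hV, key fun b hb => (hV b hb).symm⟩

/-- ★★ **THE CHART IS LOCAL IN THE BASE CONFIGURATION**: `U = U′` on `inputs 𝐁` ⇒ `Ψ_{𝐁,W,U} = Ψ_{𝐁,W,U′}` as functions of the chart variable (standing range `k ≤ m + K`) — so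
its derivative, second derivative, level set and submersivity at `0` are those of `Ψ_{𝐁,W,U′}`. [cite: Balaban1985Variational, (82)–(83) p.290; Balaban1988Convergent, (2.10)–(2.12) p.256] -/
theorem msChart_congr_of_eqOn_inputs (hk : k ≤ (F.P K).m + (F.P K).K) (h : ∀ b ∈ inputs 𝔹, U b = U' b) :
    msChart F N K k 𝔹 W U = msChart F N K k 𝔹 W U' := by
  funext X i
  have hav := avgFamily_expChart_eq_of_eqOn_inputs hk h X (j := (((constrEnum 𝔹 k).symm i).1 : ℕ))
    (Nat.le_of_lt_succ ((constrEnum 𝔹 k).symm i).1.2) ((constrEnum 𝔹 k).symm i).2.2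
  rw [msChart_apply, msChart_apply, relAvg, relAvg, hav]

/-- ★ **`IsFibreChartNear` is local in the base configuration** (for ANY candidate chart `Φ`, `Φ′`: only its fibre clause mentions `U`, through the local fibre condition along `U·e^X`).
[cite: Balaban1985Variational, (82)–(83) p.290; Balaban1988Convergent, (2.10)–(2.11) p.256] -/
theorem isFibreChartNear_iff_of_eqOn_inputs (h𝔹 : ∀ j, k < j → 𝔹 j = ∅) (hk : k ≤ (F.P K).m + (F.P K).K) (h : ∀ b ∈ inputs 𝔹, U b = U' b)
    {V : Type*} [NormedAddCommGroup V] [NormedSpace ℝ V] [FiniteDimensional ℝ V]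
    {Φ : (PBond (F.P K) 0 → lieSU (Fin N)) → V} {Φ' : (PBond (F.P K) 0 → lieSU (Fin N)) →L[ℝ] V} :
    IsFibreChartNear F N K 𝔹 W U Φ Φ' ↔ IsFibreChartNear F N K 𝔹 W U' Φ Φ' := by
  unfold IsFibreChartNear
  refine and_congr_right fun _ => and_congr_right fun _ => Filter.eventually_congr (Filter.Eventually.of_forall fun X => ?_)
  exact imp_congr_right fun _ => agreeOn_iff_of_eqOn_inputs h𝔹 hk (expChart_eqOn h X)

/-! ## §2  The flattened proxy: near-flat on a bond set ⇒ a globally near-flat configuration agreeing there -/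

omit [NeZero N] in
/-- **FLATTEN OFF `S`**: a configuration `ρ`-near-flat on a bond set `S` agrees on `S` with a GLOBALLY `ρ`-near-flat configuration (itself on `S`, the identity elsewhere).
[cite: Balaban1989LargeFieldII, (1.77) p.373 (bookkeeping: the smallness is used only near the constraint region)] -/
theorem exists_nearFlat_eqOn (U : GaugeField (F.P K) 0 (SU N)) (S : Set (PBond (F.P K) 0)) {ρ : ℝ} (hρ : 0 ≤ ρ)
    (hloc : ∀ b ∈ S, ‖((U b : SU N) : Matrix (Fin N) (Fin N) ℂ) - 1‖ ≤ ρ) :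
    ∃ U' : GaugeField (F.P K) 0 (SU N), (∀ b ∈ S, U' b = U b) ∧ ‖coeField U' - 1‖ ≤ ρ := by
  classical
  refine ⟨fun b => if b ∈ S then U b else 1, fun b hb => if_pos hb, (pi_norm_le_iff_of_nonneg hρ).2 fun b => ?_⟩
  simp only [Pi.sub_apply, Pi.one_apply, coeField]
  by_cases hb : b ∈ S
  · rw [if_pos hb]
    exact hloc b hb
  · rw [if_neg hb]
    simp [hρ]

/-! ## §3  Proxy currency: the chart letters at `U` from a guarded proxy `U′` in the fibre agreeing with `U` on `inputs 𝐁` -/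

section Proxy

variable (hk : k ≤ (F.P K).m + (F.P K).K) (hin : ∀ b ∈ inputs 𝔹, U' b = U b)
  (hU' : AgreeOn 𝔹 (avgFamily (avOfRecord F N K) U') W) (hsb' : SmallBelow (avOfRecord F N K) k U')
include hk hin hU' hsb'

/-- The chart at `U` is strictly differentiable at `0` (binder currency), from a guarded proxy. [cite: Balaban1985Variational, (82)–(83) p.290] -/
theorem hasStrictFDerivAt_msChart_of_proxy : HasStrictFDerivAt (msChart F N K k 𝔹 W U) (fderiv ℝ (msChart F N K k 𝔹 W U) 0) 0 := by
  rw [msChart_congr_of_eqOn_inputs hk fun b hb => (hin b hb).symm]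
  exact hasStrictFDerivAt_msChart hU' hsb'

/-- The binder `hΨ` at `U` from a guarded proxy: the chart is differentiable at `0`. [cite: Balaban1985Variational, (82)–(83) p.290 (bookkeeping)] -/
theorem differentiableAt_msChart_of_proxy : DifferentiableAt ℝ (msChart F N K k 𝔹 W U) 0 :=
  (hasStrictFDerivAt_msChart_of_proxy hk hin hU' hsb').hasFDerivAt.differentiableAt

/-- The chart at `U` is `C^∞` at `0`, from a guarded proxy. [cite: Balaban1985Variational, Sect. C p.285, (82)–(83) p.290] -/
theorem contDiffAt_msChart_of_proxy : ContDiffAt ℝ ⊤ (msChart F N K k 𝔹 W U) 0 := by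
  rw [msChart_congr_of_eqOn_inputs hk fun b hb => (hin b hb).symm]
  exact contDiffAt_msChart hU' hsb'

/-- The binder `hΨ₂` at `U` from a guarded proxy: `Y ↦ DΨ(Y)` is differentiable at `0` with derivative `D²Ψ(0)`. [cite: Balaban1985Variational, (81)–(83) p.290] -/
theorem hasFDerivAt_fderiv_msChart_of_proxy :
    HasFDerivAt (fun Y => fderiv ℝ (msChart F N K k 𝔹 W U) Y) (fderiv ℝ (fderiv ℝ (msChart F N K k 𝔹 W U)) 0) 0 := by
  rw [msChart_congr_of_eqOn_inputs hk fun b hb => (hin b hb).symm]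
  exact hasFDerivAt_fderiv_msChart hU' hsb'

/-- The level set of the chart through `0` lies in the fibre near `0`, at `U`, from a guarded proxy (for `𝐁` with no member above `k`).
[cite: Balaban1985Variational, (3) p.278, (82)–(83) p.290; Balaban1988Convergent, (2.10) p.256] -/
theorem eventually_agreeOn_of_msChart_eq_of_proxy (h𝔹 : ∀ j, k < j → 𝔹 j = ∅) :
    ∀ᶠ X in 𝓝 (0 : PBond (F.P K) 0 → lieSU (Fin N)),
      msChart F N K k 𝔹 W U X = msChart F N K k 𝔹 W U 0 → AgreeOn 𝔹 (avgFamily (avOfRecord F N K) (expChart U X)) W := by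
  rw [msChart_congr_of_eqOn_inputs hk fun b hb => (hin b hb).symm]
  filter_upwards [eventually_agreeOn_of_msChart_eq h𝔹 hU' hsb'] with X hX hΦ
  exact (agreeOn_iff_of_eqOn_inputs h𝔹 hk (expChart_eqOn (fun b hb => hin b hb) X)).1 (hX hΦ)

/-- ★ **`IsFibreChartNear` FOR THE CANONICAL CHART AT `U` FROM A GUARDED PROXY**, once `DΨ(0)` is onto. [cite: Balaban1985Variational, (45)–(48) p.285, (82)–(83) p.290; Balaban1988Convergent, (2.10)–(2.12) p.256] -/
theorem isFibreChartNear_msChart_of_surjective_of_proxy (h𝔹 : ∀ j, k < j → 𝔹 j = ∅)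
    (hsurj : Function.Surjective (fderiv ℝ (msChart F N K k 𝔹 W U) 0)) :
    IsFibreChartNear F N K 𝔹 W U (msChart F N K k 𝔹 W U) (fderiv ℝ (msChart F N K k 𝔹 W U) 0) :=
  ⟨hasStrictFDerivAt_msChart_of_proxy hk hin hU' hsb', LinearMap.range_eq_top.2 hsurj, eventually_agreeOn_of_msChart_eq_of_proxy hk hin hU' hsb' h𝔹⟩

/-- ★★ **THE LAGRANGE MULTIPLIER AT `U` WITHOUT THE GLOBAL GUARD**: for `𝐁` with no member above `k ≤ m + K`, a guarded proxy `U′` in the fibre agreeing with `U` on `inputs 𝐁`, `DΨ(0)`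
onto and `U` curve-critical on the fibre, `D(A∘expChart U)(0) = λ ∘ DΨ(0)` for some `λ`. [cite: Balaban1985Variational, (82)–(83) p.290, p.300; Balaban1989LargeFieldII, (1.12) p.359] -/
theorem exists_lam_msChart_of_surjective_of_proxy (h𝔹 : ∀ j, k < j → 𝔹 j = ∅)
    (hsurj : Function.Surjective (fderiv ℝ (msChart F N K k 𝔹 W U) 0)) (hcrit : IsCritOnFibre F N K 𝔹 W U) :
    ∃ lam : (Fin (constrCard 𝔹 k) → lieSU (Fin N)) →L[ℝ] ℝ,
      fderiv ℝ (fun Y : PBond (F.P K) 0 → lieSU (Fin N) => wilsonAction4 (expChart U Y)) 0 = lam.comp (fderiv ℝ (msChart F N K k 𝔹 W U) 0) :=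
  exists_lam_of_isFibreChartNear_of_isCritOnFibre (isFibreChartNear_msChart_of_surjective_of_proxy hk hin hU' hsb' h𝔹 hsurj) hcrit

/-- The binder `hΨd` at `U` from a guarded proxy: the chart is differentiable at every point near `0`. [cite: Balaban1985Variational, (81)–(83) p.290 (bookkeeping)] -/
theorem eventually_differentiableAt_msChart_of_proxy :
    ∀ᶠ Y in 𝓝 (0 : PBond (F.P K) 0 → lieSU (Fin N)), DifferentiableAt ℝ (msChart F N K k 𝔹 W U) Y := by
  rw [msChart_congr_of_eqOn_inputs hk fun b hb => (hin b hb).symm]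
  exact eventually_differentiableAt_msChart hU' hsb'

/-- **The J-C regularity pair `hΨ₂` ∕ `hΨd` at `U` from a guarded proxy** (`Ψ₂ := D²Ψ(0)`). [cite: Balaban1985Variational, (81)–(83) p.290 (bookkeeping)] -/
theorem regularity_binders_msChart_of_proxy :
    HasFDerivAt (fun Y => fderiv ℝ (msChart F N K k 𝔹 W U) Y) (fderiv ℝ (fderiv ℝ (msChart F N K k 𝔹 W U)) 0) 0 ∧
      ∀ᶠ Y in 𝓝 (0 : PBond (F.P K) 0 → lieSU (Fin N)), DifferentiableAt ℝ (msChart F N K k 𝔹 W U) Y :=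
  ⟨hasFDerivAt_fderiv_msChart_of_proxy hk hin hU' hsb', eventually_differentiableAt_msChart_of_proxy hk hin hU' hsb'⟩

/-- ★ **THE MULTIPLIER AND ITS BOUND `|λ v| ≤ j·ρ·q v` AT `U` FROM A GUARDED PROXY** (p610492's `exists_lam_msChart_bound_of_rightInverse_fun` without the global guard at `U`): a
right-inverse FUNCTION `R` of `DΨ(0)` with `p(Rv) ≤ ρ·q v` and the first-variation bound `|D(A∘expChart U)(0)x| ≤ j·p x`.
[cite: Balaban1989LargeFieldII, (1.12) p.359; Balaban1985Variational, (82)–(83) p.290, p.300] -/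
theorem exists_lam_msChart_bound_of_rightInverse_fun_of_proxy (h𝔹 : ∀ j, k < j → 𝔹 j = ∅)
    (p : Seminorm ℝ (PBond (F.P K) 0 → lieSU (Fin N))) (q : (Fin (constrCard 𝔹 k) → lieSU (Fin N)) → ℝ)
    {R : (Fin (constrCard 𝔹 k) → lieSU (Fin N)) → PBond (F.P K) 0 → lieSU (Fin N)} (hR : ∀ v, fderiv ℝ (msChart F N K k 𝔹 W U) 0 (R v) = v)
    {j ρ : ℝ} (hj0 : 0 ≤ j) (hj : ∀ x, |fderiv ℝ (fun Y : PBond (F.P K) 0 → lieSU (Fin N) => wilsonAction4 (expChart U Y)) 0 x| ≤ j * p x)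
    (hρ : ∀ v, p (R v) ≤ ρ * q v) (hcrit : IsCritOnFibre F N K 𝔹 W U) :
    ∃ lam : (Fin (constrCard 𝔹 k) → lieSU (Fin N)) →L[ℝ] ℝ,
      fderiv ℝ (fun Y : PBond (F.P K) 0 → lieSU (Fin N) => wilsonAction4 (expChart U Y)) 0 = lam.comp (fderiv ℝ (msChart F N K k 𝔹 W U) 0) ∧
        ∀ v, |lam v| ≤ j * ρ * q v := by
  obtain ⟨lam, hlam⟩ := exists_lam_msChart_of_surjective_of_proxy hk hin hU' hsb' h𝔹 (fun v => ⟨R v, hR v⟩) hcrit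
  exact ⟨lam, hlam, fun v => B16Ineq17NearFlatOneSidedSeminorm.abs_multiplier_apply_le_seminorm p q _ _ hR hlam hj0 hj hρ v⟩

/-- ★★ **THE PAIR (`hlam`, `μ`) AT `U` FROM A GUARDED PROXY** (p613093's `exists_lam_mu_msChart_of_rightInverse_fun` without the global guard at `U`): the multiplier identity and
`λ(D²Ψ(0)(w,w)) ≤ μ·p(w)²` with `μ = j·ρ·N·M₂ ≥ 0` (the curvature constant `M₂` of `D²Ψ_U(0)` is unconditional — a bilinear map on a finite-dimensional space).
[cite: Balaban1989LargeFieldII, (1.12) p.359; Balaban1985Variational, (81)–(83) p.290, p.300] -/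
theorem exists_lam_mu_msChart_of_rightInverse_fun_of_proxy (h𝔹 : ∀ j, k < j → 𝔹 j = ∅)
    (p : Seminorm ℝ (PBond (F.P K) 0 → lieSU (Fin N)))
    (hp : ∀ Y : PBond (F.P K) 0 → lieSU (Fin N), ∑ b, ‖(Y b : Matrix (Fin N) (Fin N) ℂ)‖ ^ 2 ≤ p Y ^ 2)
    {R : (Fin (constrCard 𝔹 k) → lieSU (Fin N)) → PBond (F.P K) 0 → lieSU (Fin N)} (hR : ∀ v, fderiv ℝ (msChart F N K k 𝔹 W U) 0 (R v) = v)
    {j ρ : ℝ} (hj0 : 0 ≤ j) (hρ0 : 0 ≤ ρ)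
    (hj : ∀ x, |fderiv ℝ (fun Y : PBond (F.P K) 0 → lieSU (Fin N) => wilsonAction4 (expChart U Y)) 0 x| ≤ j * p x)
    (hρ : ∀ v, p (R v) ≤ ρ * ‖v‖) (hcrit : IsCritOnFibre F N K 𝔹 W U) :
    ∃ lam : (Fin (constrCard 𝔹 k) → lieSU (Fin N)) →L[ℝ] ℝ, ∃ μ : ℝ, 0 ≤ μ ∧
      fderiv ℝ (fun Y : PBond (F.P K) 0 → lieSU (Fin N) => wilsonAction4 (expChart U Y)) 0 = lam.comp (fderiv ℝ (msChart F N K k 𝔹 W U) 0) ∧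
        ∀ w : PBond (F.P K) 0 → lieSU (Fin N), lam (fderiv ℝ (fderiv ℝ (msChart F N K k 𝔹 W U)) 0 w w) ≤ μ * p w ^ 2 := by
  obtain ⟨lam, hlam, hbd⟩ := exists_lam_msChart_bound_of_rightInverse_fun_of_proxy hk hin hU' hsb' h𝔹 p (fun v => ‖v‖) hR hj0 hj hρ hcrit
  obtain ⟨M₂, hM₂, hcurv⟩ := exists_chartCurvature_sq_bound_seminorm (F := F) (N := N) (K := K) (k := k) (𝔹 := 𝔹) (W := W) (U := U) p hp
  refine ⟨lam, j * ρ * (N * M₂), by positivity, hlam, fun w => ?_⟩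
  calc lam (fderiv ℝ (fderiv ℝ (msChart F N K k 𝔹 W U)) 0 w w)
        ≤ |lam (fderiv ℝ (fderiv ℝ (msChart F N K k 𝔹 W U)) 0 w w)| := le_abs_self _
    _ ≤ j * ρ * ‖fderiv ℝ (fderiv ℝ (msChart F N K k 𝔹 W U)) 0 w w‖ := hbd _
    _ ≤ j * ρ * (N * M₂ * p w ^ 2) := mul_le_mul_of_nonneg_left (hcurv w) (by positivity)
    _ = j * ρ * (N * M₂) * p w ^ 2 := by ring

end Proxy

/-- ★★ **THE PAIR (`hlam`, `μ`) AT THE N12∕s1 ENDPOINT's OBJECTS FROM A GUARDED PROXY** (p613093's `exists_lam_mu_msChart_Bj_of_isMinimizer_regMSCoPOfRecord` with the global guard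
`SmallBelow … k U₀` at the minimiser REPLACED by a guarded proxy `U′` agreeing with `U₀` on `inputs (Bj M₁ Z k)`): class of record `regMSCoPOfRecord`, determining set `𝐁_k(Z)`,
`U₀` a (2.12) minimiser (so in the fibre and curve-critical); the proxy's fibre membership is transported from `U₀`'s.
[cite: Balaban1989LargeFieldII, (1.12) p.359; Balaban1985Variational, (82)–(83) p.290, p.299–300; Balaban1988Convergent, (2.11)–(2.13) pp.256–257] -/
theorem exists_lam_mu_msChart_Bj_of_isMinimizer_regMSCoPOfRecord_of_proxy (ν : Stage7Numerics) {k' : ℕ} (Ω : ℕ → Set (Site (F.P K) 0)) (M₁ : ℕ)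
    (Z : Set (Site (F.P K) 0)) {W : MSField (F.P K) (SU N)} {U₀ U' : GaugeField (F.P K) 0 (SU N)} (hk : k ≤ (F.P K).m + (F.P K).K)
    (h : IsMinimizer (avOfRecord F N K) (regMSCoPOfRecord F N ν K k' Ω) (Bj M₁ Z k) W U₀)
    (hin : ∀ b ∈ inputs (Bj M₁ Z k), U' b = U₀ b) (hsb' : SmallBelow (avOfRecord F N K) k U')
    (p : Seminorm ℝ (PBond (F.P K) 0 → lieSU (Fin N)))
    (hp : ∀ Y : PBond (F.P K) 0 → lieSU (Fin N), ∑ b, ‖(Y b : Matrix (Fin N) (Fin N) ℂ)‖ ^ 2 ≤ p Y ^ 2)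
    {R : (Fin (constrCard (Bj M₁ Z k) k) → lieSU (Fin N)) → PBond (F.P K) 0 → lieSU (Fin N)}
    (hR : ∀ v, fderiv ℝ (msChart F N K k (Bj M₁ Z k) W U₀) 0 (R v) = v)
    {j ρ : ℝ} (hj0 : 0 ≤ j) (hρ0 : 0 ≤ ρ)
    (hj : ∀ x, |fderiv ℝ (fun Y : PBond (F.P K) 0 → lieSU (Fin N) => wilsonAction4 (expChart U₀ Y)) 0 x| ≤ j * p x)
    (hρ : ∀ v, p (R v) ≤ ρ * ‖v‖) :
    ∃ lam : (Fin (constrCard (Bj M₁ Z k) k) → lieSU (Fin N)) →L[ℝ] ℝ, ∃ μ : ℝ, 0 ≤ μ ∧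
      fderiv ℝ (fun Y : PBond (F.P K) 0 → lieSU (Fin N) => wilsonAction4 (expChart U₀ Y)) 0 = lam.comp (fderiv ℝ (msChart F N K k (Bj M₁ Z k) W U₀) 0) ∧
        ∀ w : PBond (F.P K) 0 → lieSU (Fin N), lam (fderiv ℝ (fderiv ℝ (msChart F N K k (Bj M₁ Z k) W U₀)) 0 w w) ≤ μ * p w ^ 2 :=
  have h𝔹 : ∀ j, k < j → Bj M₁ Z k j = ∅ := fun _ hj' => Bj_of_gt hj'
  exists_lam_mu_msChart_of_rightInverse_fun_of_proxy hk hin ((agreeOn_iff_of_eqOn_inputs (W := W) h𝔹 hk fun b hb => (hin b hb).symm).1 h.2.1) hsb' h𝔹 p hp hR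
    hj0 hρ0 hj hρ (isCritOnFibre_of_isMinimizer_regMSCoPOfRecord ν Ω h)

/-! ## §4  Near-flat-on-inputs currency: one radius per height; the uniform curvature bound, local edition -/

/-- ★★ **ONE RADIUS PER HEIGHT FOR PROXIES**: there is `ρ″ > 0` such that every configuration `U` in the fibre of `W` on a determining set `𝐁` with no member above `k ≤ m + K` that is
`ρ″`-near-flat ON `inputs 𝐁` has a proxy `U′` — agreeing with `U` on `inputs 𝐁`, globally `ρ″`-near-flat, GUARDED below `k`, and in the same fibre.
[cite: Balaban1987RG1, (0.4) p.253, (0.21) p.256; Balaban1988Convergent, (2.10)–(2.11) p.256] -/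
theorem exists_radius_proxy (k : ℕ) :
    ∃ ρ'' : ℝ, 0 < ρ'' ∧ ∀ (𝔹 : DetSet (F.P K)) (W : MSField (F.P K) (SU N)) (U : GaugeField (F.P K) 0 (SU N)),
      (∀ j, k < j → 𝔹 j = ∅) → k ≤ (F.P K).m + (F.P K).K →
      (∀ b ∈ inputs 𝔹, ‖((U b : SU N) : Matrix (Fin N) (Fin N) ℂ) - 1‖ ≤ ρ'') → AgreeOn 𝔹 (avgFamily (avOfRecord F N K) U) W →
      ∃ U' : GaugeField (F.P K) 0 (SU N), (∀ b ∈ inputs 𝔹, U' b = U b) ∧ ‖coeField U' - 1‖ ≤ ρ'' ∧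
        SmallBelow (avOfRecord F N K) k U' ∧ AgreeOn 𝔹 (avgFamily (avOfRecord F N K) U') W := by
  obtain ⟨_, ρ'', _, hρ, hguard, _⟩ := exists_uniform_chartCurvature_sq_bound (F := F) (N := N) (K := K) k
  refine ⟨ρ'', hρ, fun 𝔹 W U h𝔹 hk hloc hU => ?_⟩
  obtain ⟨U', hin, hflat⟩ := exists_nearFlat_eqOn U (inputs 𝔹) hρ.le hloc
  exact ⟨U', hin, hflat, hguard U' hflat, (agreeOn_iff_of_eqOn_inputs (W := W) h𝔹 hk fun b hb => (hin b hb).symm).1 hU⟩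

/-- ★★★ **THE UNIFORM CURVATURE BOUND, LOCAL EDITION**: `M₂ ≥ 0` and `ρ″ > 0` depending only on the height `k` (and the lattice data) such that for every determining set `𝐁` with no member
above `k ≤ m + K`, every datum `W` and every `U₀` in the fibre that is `ρ″`-near-flat ON `inputs 𝐁` ONLY: the chart is differentiable at `0`, `Y ↦ DΨ(Y)` is differentiable at `0`, and
`‖D²Ψ_{U₀}(0)(w,w)‖ ≤ M₂‖w‖²` — p615328's `exists_uniform_chartCurvature_sq_bound` with its global near-flatness replaced by near-flatness on `inputs 𝐁`.
[cite: Balaban1985Variational, (81)–(83) p.290; Balaban1987RG1, (0.4) p.253; Balaban1988Convergent, (2.10)–(2.12) p.256] -/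
theorem exists_uniform_chartCurvature_sq_bound_local (k : ℕ) :
    ∃ M₂ ρ'' : ℝ, 0 ≤ M₂ ∧ 0 < ρ'' ∧
      ∀ (𝔹 : DetSet (F.P K)) (W : MSField (F.P K) (SU N)) (U₀ : GaugeField (F.P K) 0 (SU N)),
        (∀ j, k < j → 𝔹 j = ∅) → k ≤ (F.P K).m + (F.P K).K →
        (∀ b ∈ inputs 𝔹, ‖((U₀ b : SU N) : Matrix (Fin N) (Fin N) ℂ) - 1‖ ≤ ρ'') → AgreeOn 𝔹 (avgFamily (avOfRecord F N K) U₀) W →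
        DifferentiableAt ℝ (msChart F N K k 𝔹 W U₀) 0 ∧
        HasFDerivAt (fun Y => fderiv ℝ (msChart F N K k 𝔹 W U₀) Y) (fderiv ℝ (fderiv ℝ (msChart F N K k 𝔹 W U₀)) 0) 0 ∧
        ∀ w : PBond (F.P K) 0 → lieSU (Fin N), ‖fderiv ℝ (fderiv ℝ (msChart F N K k 𝔹 W U₀)) 0 w w‖ ≤ M₂ * ‖w‖ ^ 2 := by
  obtain ⟨M₂, ρ'', hM₂, hρ, hguard, hcurv⟩ := exists_uniform_chartCurvature_sq_bound (F := F) (N := N) (K := K) k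
  refine ⟨M₂, ρ'', hM₂, hρ, fun 𝔹 W U₀ h𝔹 hk hloc hU => ?_⟩
  obtain ⟨U', hin, hflat⟩ := exists_nearFlat_eqOn U₀ (inputs 𝔹) hρ.le hloc
  have hsb' : SmallBelow (avOfRecord F N K) k U' := hguard U' hflat
  have hU' : AgreeOn 𝔹 (avgFamily (avOfRecord F N K) U') W := (agreeOn_iff_of_eqOn_inputs (W := W) h𝔹 hk fun b hb => (hin b hb).symm).1 hU
  refine ⟨differentiableAt_msChart_of_proxy hk hin hU' hsb', hasFDerivAt_fderiv_msChart_of_proxy hk hin hU' hsb', fun w => ?_⟩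
  rw [msChart_congr_of_eqOn_inputs (W := W) hk fun b hb => (hin b hb).symm]
  exact hcurv 𝔹 W U' hflat hU' w

/-! ## §5  v1.1 (CLAIM-10): the multiplier bound with the first-variation letter asked ONLY ON THE RANGE of the right inverse

`|λ v| = |φ(R v)| ≤ j·p(R v) ≤ j·ρ·q(v)` uses the current letter `hj` only at `x = R v`; with §7 of `BalabanUVNodesN12NearFlatDelta2Letter` (`R v = Hf w`, `Hf` supported under the
constrained blocks) the letter is then needed only for directions supported there — the LOCALISED first variation of `B16Ineq17NearFlatWilsonLettersLocal`. -/

section Range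

variable {E V : Type*} [NormedAddCommGroup E] [NormedSpace ℝ E] [NormedAddCommGroup V] [NormedSpace ℝ V]

/-- **MULTIPLIER BOUND, CURRENT LETTER ON THE RANGE OF `R` ONLY**: `φ = λ ∘ L`, `L(Rv) = v`, `|φ(Rv)| ≤ j·p(Rv)`, `p(Rv) ≤ ρ·q(v)` ⇒ `|λ v| ≤ jρ·q(v)`.
[cite: Balaban1989LargeFieldII, (1.12) p.359; Balaban1985Variational, (82)–(83) p.290] -/
theorem abs_multiplier_apply_le_seminorm_of_range (p : Seminorm ℝ E) (q : V → ℝ) (φ : E →L[ℝ] ℝ) (L : E →L[ℝ] V) {R : V → E}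
    (hR : ∀ v, L (R v) = v) {lam : V →L[ℝ] ℝ} (hlam : φ = lam.comp L) {j ρ : ℝ} (hj0 : 0 ≤ j) (hj : ∀ v, |φ (R v)| ≤ j * p (R v))
    (hρ : ∀ v, p (R v) ≤ ρ * q v) (v : V) : |lam v| ≤ j * ρ * q v := by
  have h1 : lam v = φ (R v) := by rw [hlam, ContinuousLinearMap.comp_apply, hR]
  rw [h1]
  calc |φ (R v)| ≤ j * p (R v) := hj _
    _ ≤ j * (ρ * q v) := mul_le_mul_of_nonneg_left (hρ v) hj0
    _ = j * ρ * q v := by ring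

end Range

section ProxyRange

variable (hk : k ≤ (F.P K).m + (F.P K).K) (hin : ∀ b ∈ inputs 𝔹, U' b = U b)
  (hU' : AgreeOn 𝔹 (avgFamily (avOfRecord F N K) U') W) (hsb' : SmallBelow (avOfRecord F N K) k U')
include hk hin hU' hsb'

/-- ★ **THE MULTIPLIER AND ITS BOUND AT `U` FROM A GUARDED PROXY, CURRENT LETTER ON THE RANGE OF `R`**: as `exists_lam_msChart_bound_of_rightInverse_fun_of_proxy` with
`hj : ∀ v, |D(A∘expChart U)(0)(R v)| ≤ j·p(R v)`. [cite: Balaban1989LargeFieldII, (1.12) p.359; Balaban1985Variational, (82)–(83) p.290, p.300] -/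
theorem exists_lam_msChart_bound_of_proxy_of_range (h𝔹 : ∀ j, k < j → 𝔹 j = ∅)
    (p : Seminorm ℝ (PBond (F.P K) 0 → lieSU (Fin N))) (q : (Fin (constrCard 𝔹 k) → lieSU (Fin N)) → ℝ)
    {R : (Fin (constrCard 𝔹 k) → lieSU (Fin N)) → PBond (F.P K) 0 → lieSU (Fin N)} (hR : ∀ v, fderiv ℝ (msChart F N K k 𝔹 W U) 0 (R v) = v)
    {j ρ : ℝ} (hj0 : 0 ≤ j) (hj : ∀ v, |fderiv ℝ (fun Y : PBond (F.P K) 0 → lieSU (Fin N) => wilsonAction4 (expChart U Y)) 0 (R v)| ≤ j * p (R v))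
    (hρ : ∀ v, p (R v) ≤ ρ * q v) (hcrit : IsCritOnFibre F N K 𝔹 W U) :
    ∃ lam : (Fin (constrCard 𝔹 k) → lieSU (Fin N)) →L[ℝ] ℝ,
      fderiv ℝ (fun Y : PBond (F.P K) 0 → lieSU (Fin N) => wilsonAction4 (expChart U Y)) 0 = lam.comp (fderiv ℝ (msChart F N K k 𝔹 W U) 0) ∧
        ∀ v, |lam v| ≤ j * ρ * q v := by
  obtain ⟨lam, hlam⟩ := exists_lam_msChart_of_surjective_of_proxy hk hin hU' hsb' h𝔹 (fun v => ⟨R v, hR v⟩) hcrit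
  exact ⟨lam, hlam, fun v => abs_multiplier_apply_le_seminorm_of_range p q _ _ hR hlam hj0 hj hρ v⟩

/-- ★★ **THE PAIR (`hlam`, `μ`) AT `U` FROM A GUARDED PROXY, CURRENT LETTER ON THE RANGE OF `R`**: as `exists_lam_mu_msChart_of_rightInverse_fun_of_proxy` with the weaker `hj`.
[cite: Balaban1989LargeFieldII, (1.12) p.359; Balaban1985Variational, (81)–(83) p.290, p.300] -/
theorem exists_lam_mu_msChart_of_proxy_of_range (h𝔹 : ∀ j, k < j → 𝔹 j = ∅)
    (p : Seminorm ℝ (PBond (F.P K) 0 → lieSU (Fin N)))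
    (hp : ∀ Y : PBond (F.P K) 0 → lieSU (Fin N), ∑ b, ‖(Y b : Matrix (Fin N) (Fin N) ℂ)‖ ^ 2 ≤ p Y ^ 2)
    {R : (Fin (constrCard 𝔹 k) → lieSU (Fin N)) → PBond (F.P K) 0 → lieSU (Fin N)} (hR : ∀ v, fderiv ℝ (msChart F N K k 𝔹 W U) 0 (R v) = v)
    {j ρ : ℝ} (hj0 : 0 ≤ j) (hρ0 : 0 ≤ ρ)
    (hj : ∀ v, |fderiv ℝ (fun Y : PBond (F.P K) 0 → lieSU (Fin N) => wilsonAction4 (expChart U Y)) 0 (R v)| ≤ j * p (R v))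
    (hρ : ∀ v, p (R v) ≤ ρ * ‖v‖) (hcrit : IsCritOnFibre F N K 𝔹 W U) :
    ∃ lam : (Fin (constrCard 𝔹 k) → lieSU (Fin N)) →L[ℝ] ℝ, ∃ μ : ℝ, 0 ≤ μ ∧
      fderiv ℝ (fun Y : PBond (F.P K) 0 → lieSU (Fin N) => wilsonAction4 (expChart U Y)) 0 = lam.comp (fderiv ℝ (msChart F N K k 𝔹 W U) 0) ∧
        ∀ w : PBond (F.P K) 0 → lieSU (Fin N), lam (fderiv ℝ (fderiv ℝ (msChart F N K k 𝔹 W U)) 0 w w) ≤ μ * p w ^ 2 := by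
  obtain ⟨lam, hlam, hbd⟩ := exists_lam_msChart_bound_of_proxy_of_range hk hin hU' hsb' h𝔹 p (fun v => ‖v‖) hR hj0 hj hρ hcrit
  obtain ⟨M₂, hM₂, hcurv⟩ := exists_chartCurvature_sq_bound_seminorm (F := F) (N := N) (K := K) (k := k) (𝔹 := 𝔹) (W := W) (U := U) p hp
  refine ⟨lam, j * ρ * (N * M₂), by positivity, hlam, fun w => ?_⟩
  calc lam (fderiv ℝ (fderiv ℝ (msChart F N K k 𝔹 W U)) 0 w w)
        ≤ |lam (fderiv ℝ (fderiv ℝ (msChart F N K k 𝔹 W U)) 0 w w)| := le_abs_self _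
    _ ≤ j * ρ * ‖fderiv ℝ (fderiv ℝ (msChart F N K k 𝔹 W U)) 0 w w‖ := hbd _
    _ ≤ j * ρ * (N * M₂ * p w ^ 2) := mul_le_mul_of_nonneg_left (hcurv w) (by positivity)
    _ = j * ρ * (N * M₂) * p w ^ 2 := by ring

end ProxyRange

/-- ★★ **THE PAIR (`hlam`, `μ`) AT THE N12∕s1 ENDPOINT's OBJECTS FROM A GUARDED PROXY, CURRENT LETTER ON THE RANGE OF `R`** — the edition the knit uses when `R v = Hf w` is supported
under the constrained blocks and `U₀` is near-flat only there. [cite: Balaban1989LargeFieldII, (1.12) p.359; Balaban1985Variational, (82)–(83) p.290, p.299–300; Balaban1988Convergent, (2.11)–(2.13) pp.256–257] -/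
theorem exists_lam_mu_msChart_Bj_of_isMinimizer_regMSCoPOfRecord_of_proxy_of_range (ν : Stage7Numerics) {k' : ℕ} (Ω : ℕ → Set (Site (F.P K) 0)) (M₁ : ℕ)
    (Z : Set (Site (F.P K) 0)) {W : MSField (F.P K) (SU N)} {U₀ U' : GaugeField (F.P K) 0 (SU N)} (hk : k ≤ (F.P K).m + (F.P K).K)
    (h : IsMinimizer (avOfRecord F N K) (regMSCoPOfRecord F N ν K k' Ω) (Bj M₁ Z k) W U₀)
    (hin : ∀ b ∈ inputs (Bj M₁ Z k), U' b = U₀ b) (hsb' : SmallBelow (avOfRecord F N K) k U')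
    (p : Seminorm ℝ (PBond (F.P K) 0 → lieSU (Fin N)))
    (hp : ∀ Y : PBond (F.P K) 0 → lieSU (Fin N), ∑ b, ‖(Y b : Matrix (Fin N) (Fin N) ℂ)‖ ^ 2 ≤ p Y ^ 2)
    {R : (Fin (constrCard (Bj M₁ Z k) k) → lieSU (Fin N)) → PBond (F.P K) 0 → lieSU (Fin N)}
    (hR : ∀ v, fderiv ℝ (msChart F N K k (Bj M₁ Z k) W U₀) 0 (R v) = v)
    {j ρ : ℝ} (hj0 : 0 ≤ j) (hρ0 : 0 ≤ ρ)
    (hj : ∀ v, |fderiv ℝ (fun Y : PBond (F.P K) 0 → lieSU (Fin N) => wilsonAction4 (expChart U₀ Y)) 0 (R v)| ≤ j * p (R v))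
    (hρ : ∀ v, p (R v) ≤ ρ * ‖v‖) :
    ∃ lam : (Fin (constrCard (Bj M₁ Z k) k) → lieSU (Fin N)) →L[ℝ] ℝ, ∃ μ : ℝ, 0 ≤ μ ∧
      fderiv ℝ (fun Y : PBond (F.P K) 0 → lieSU (Fin N) => wilsonAction4 (expChart U₀ Y)) 0 = lam.comp (fderiv ℝ (msChart F N K k (Bj M₁ Z k) W U₀) 0) ∧
        ∀ w : PBond (F.P K) 0 → lieSU (Fin N), lam (fderiv ℝ (fderiv ℝ (msChart F N K k (Bj M₁ Z k) W U₀)) 0 w w) ≤ μ * p w ^ 2 :=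
  have h𝔹 : ∀ j, k < j → Bj M₁ Z k j = ∅ := fun _ hj' => Bj_of_gt hj'
  exists_lam_mu_msChart_of_proxy_of_range hk hin ((agreeOn_iff_of_eqOn_inputs (W := W) h𝔹 hk fun b hb => (hin b hb).symm).1 h.2.1) hsb' h𝔹 p hp hR
    hj0 hρ0 hj hρ (isCritOnFibre_of_isMinimizer_regMSCoPOfRecord ν Ω h)

end Literature.MathematicalPhysics.QuantumFieldTheory.Balaban1983to89.Node00

end
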